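import Summits.MatrixMultiplication.MatrixMultiplication.Theorems.ObstructionDescentPolarLinear

/- `set_option linter.dupNamespace false` as in the sibling kernel files (namespace `…Theorems.<FileStem>`). -/
set_option linter.dupNamespace false

/-!
# Obstruction descent — basis expansion of the polar form and the permanent lemma (K3a)

Infrastructure for the prefix-form bridge deciding the aside `GapPropagation`
(route `ObstructionDescent`, item 27779; memo NODE-g23 §3):

* `polarForm_expand` — the full multilinear expansion of the polar form `P_f(y_1,…,y_d)` of a
  polynomial `f` on `ℂ^N ⊗ ℂ^N ⊗ ℂ^N` in the basis triads `e_q`: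
  `P_f(y) = Σ_{r : [d] → Pt N} (Π_k y_k(r_k)) · P_f(e_{r_1},…,e_{r_d})`;
* `coeff_ones_prod_X_comp` — the coefficient of `μ_1⋯μ_n` in `Π_l μ_{σ(l)}` is `[σ bijective]`;
* `coeff_ones_prod_slotTensor` — the PERMANENT LEMMA: the coefficient of `μ_1⋯μ_n` in
  `Π_l (Σ_{l'} v_{l'}(z_l) μ_{l'})` is `Σ_{τ ∈ S_n} Π_l v_{τ l}(z_l)`;
* small transport lemmas (`polarForm_cast`, `polarForm_zero`, sums over bijections = sums over
  `Equiv.Perm`).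

[this cell; classical multilinear algebra, cf. LandsbergManivel2004 §3 (polarisation),
Raicu2012 Prop. 3.4]
-/

namespace Summit.MatrixMultiplication.MatrixMultiplication.Theorems.ObstructionDescentPolarExpand

open MvPolynomial Finset
open ObstructionDescentPolarForm ObstructionDescentPolarLinear

variable {N d : ℕ}

/-- FULL BASIS EXPANSION of the polar form: `P_f(y) = Σ_r (Π_k y_k(r_k)) · P_f(e_r)`.
[this cell; multilinearity (`polarMultilinear`)] -/
theorem polarForm_expand (f : MvPolynomial (Pt N) ℂ) (y : Fin d → Pt N → ℂ) :
    polarForm f y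
      = ∑ r : Fin d → Pt N, (∏ k, y k (r k)) * polarForm f (fun k => basisTensor (r k)) := by
  classical
  have h0 : y = fun k : Fin d => ∑ q : Pt N, y k q • (basisTensor q : Pt N → ℂ) := by
    funext k p
    simp only [Finset.sum_apply, Pi.smul_apply, smul_eq_mul, basisTensor, mul_ite, mul_one, mul_zero,
      Finset.sum_ite_eq, mem_univ, if_true]
  calc polarForm f y = polarMultilinear f d (fun k => ∑ q : Pt N, y k q • (basisTensor q : Pt N → ℂ)) := by
        rw [← h0, polarMultilinear_apply]
    _ = ∑ r : Fin d → Pt N, polarMultilinear f d (fun k => y k (r k) • (basisTensor (r k) : Pt N → ℂ)) :=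
        MultilinearMap.map_sum (polarMultilinear f d) (fun k q => y k q • (basisTensor q : Pt N → ℂ))
    _ = _ := by
        refine Finset.sum_congr rfl fun r _ => ?_
        rw [MultilinearMap.map_smul_univ, polarMultilinear_apply, smul_eq_mul]

/-- Transport of the polar form along `Fin d = Fin d'`. [this cell] -/
theorem polarForm_cast (f : MvPolynomial (Pt N) ℂ) {d d' : ℕ} (h : d = d') (y : Fin d' → Pt N → ℂ) :
    polarForm f (fun i : Fin d => y (Fin.cast h i)) = polarForm f y := by
  subst h
  rfl

/-- The polar form of the zero polynomial vanishes. [this cell] -/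
theorem polarForm_zero (y : Fin d → Pt N → ℂ) : polarForm (0 : MvPolynomial (Pt N) ℂ) y = 0 := by
  simp [polarForm, Dpoly]

/-- `Π_l μ_{σ l} = Π_j μ_j ^ #{l | σ l = j}`. [this cell] -/
theorem prod_X_comp {n : ℕ} (σ : Fin n → Fin n) :
    ∏ l, (X (σ l) : MvPolynomial (Fin n) ℂ) = ∏ j, (X j : MvPolynomial (Fin n) ℂ) ^ #{l | σ l = j} := by
  rw [← Finset.prod_fiberwise' univ σ (fun j => (X j : MvPolynomial (Fin n) ℂ))]
  refine Finset.prod_congr rfl fun j _ => ?_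
  rw [Finset.prod_const]

/-- All fibres of a self-map of a finite type are singletons iff the map is bijective. [this cell] -/
theorem fiber_card_eq_one_iff {n : ℕ} (σ : Fin n → Fin n) :
    (∀ j, #{l | σ l = j} = 1) ↔ Function.Bijective σ := by
  constructor
  · intro h
    have hinj : Function.Injective σ := by
      intro a b hab
      obtain ⟨x, hx⟩ := Finset.card_eq_one.mp (h (σ a))
      have ha : a ∈ ({x} : Finset (Fin n)) := by
        rw [← hx]; simp
      have hb : b ∈ ({x} : Finset (Fin n)) := by
        rw [← hx]; simp [hab]
      rw [Finset.mem_singleton] at ha hb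
      rw [ha, hb]
    exact hinj.bijective_of_finite
  · intro h j
    obtain ⟨l₀, hl₀⟩ := h.2 j
    refine Finset.card_eq_one.mpr ⟨l₀, ?_⟩
    ext l
    simp only [Finset.mem_filter, Finset.mem_univ, true_and, Finset.mem_singleton]
    constructor
    · intro hl
      exact h.1 (hl.trans hl₀.symm)
    · intro hl
      rw [hl, hl₀]

/-- The coefficient of `μ_1⋯μ_n` in `Π_l μ_{σ l}` is `1` if `σ` is bijective and `0` otherwise.
[this cell] -/
theorem coeff_ones_prod_X_comp {n : ℕ} (σ : Fin n → Fin n) :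
    coeff (ones n) (∏ l, (X (σ l) : MvPolynomial (Fin n) ℂ))
      = if Function.Bijective σ then 1 else 0 := by
  rw [prod_X_comp, coeff_ones_prod_X_pow]
  by_cases h : Function.Bijective σ
  · rw [if_pos h, if_pos ((fiber_card_eq_one_iff σ).mpr h)]
  · rw [if_neg h, if_neg (fun h' => h ((fiber_card_eq_one_iff σ).mp h'))]

/-- A sum over the bijective self-maps of `Fin n` is a sum over `Equiv.Perm (Fin n)`. [this cell] -/
theorem sum_ite_bijective_eq_sum_perm {n : ℕ} (t : (Fin n → Fin n) → ℂ) :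
    ∑ σ : Fin n → Fin n, (if Function.Bijective σ then t σ else 0)
      = ∑ τ : Equiv.Perm (Fin n), t ⇑τ := by
  rw [← Finset.sum_filter]
  refine Finset.sum_bij' (fun σ hσ => Equiv.ofBijective σ (Finset.mem_filter.mp hσ).2)
    (fun τ _ => (⇑τ : Fin n → Fin n)) ?_ ?_ ?_ ?_ ?_
  · intro σ _; exact Finset.mem_univ _
  · intro τ _; exact Finset.mem_filter.mpr ⟨Finset.mem_univ _, τ.bijective⟩
  · intro σ _; rfl
  · intro τ _; ext x; rfl
  · intro σ _; rfl

/-- THE PERMANENT LEMMA. For slot tensors `v_1,…,v_n` and a tuple of basis indices `z`, the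
coefficient of `μ_1⋯μ_n` in `Π_l (Σ_{l'} v_{l'}(z_l) μ_{l'})` is the permanent-type sum
`Σ_{τ ∈ S_n} Π_l v_{τ l}(z_l)`. [this cell] -/
theorem coeff_ones_prod_slotTensor {n : ℕ} (v : Fin n → Pt N → ℂ) (z : Fin n → Pt N) :
    coeff (ones n) (∏ l, slotTensor v (z l)) = ∑ τ : Equiv.Perm (Fin n), ∏ l, v (τ l) (z l) := by
  classical
  have hexp : (∏ l, slotTensor v (z l))
      = ∑ σ : Fin n → Fin n, C (∏ l, v (σ l) (z l)) * ∏ l, (X (σ l) : MvPolynomial (Fin n) ℂ) := by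
    simp only [slotTensor]
    rw [Fintype.prod_sum (fun l l' => C (v l' (z l)) * (X l' : MvPolynomial (Fin n) ℂ))]
    refine Finset.sum_congr rfl fun σ _ => ?_
    rw [Finset.prod_mul_distrib, map_prod]
  rw [hexp, coeff_sum]
  simp only [coeff_C_mul, coeff_ones_prod_X_comp, mul_ite, mul_one, mul_zero]
  exact sum_ite_bijective_eq_sum_perm (fun σ => ∏ l, v (σ l) (z l))

/-- The number of permutations of the `n` slots. [Mathlib `Fintype.card_perm`] -/
theorem sum_perm_const {n : ℕ} (c : ℂ) :
    ∑ _τ : Equiv.Perm (Fin n), c = (n.factorial : ℂ) * c := by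
  rw [Finset.sum_const, Finset.card_univ, Fintype.card_perm, Fintype.card_fin, nsmul_eq_mul]

end Summit.MatrixMultiplication.MatrixMultiplication.Theorems.ObstructionDescentPolarExpand
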